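import Mathlib
import Summits.NavierStokesRegularity.NavierStokesRegularity.Theorems.TaoLadderRungTwoBreakOneShiftWindowGlueE2
import HarnessLib

/-!
# One-shift window certificate, kernel side — part LXV: THE WAKE-ENTRY CLAUSE `hA1` from the replay's flight-time hull,
# the enclosure of the renormalisation factor and the wake tube centre boxes
# (cell harvest/h2-tao-ladder, seat p2; rung1/RUNG1-P2G16-REPORT.md §81; support for K1(1) = `NoSurvivingDSSOne`,
# stmt-NavierStokesRegularity-20205)

MODEL lattice only (the finite WINDOW system of a Tao-type averaged cascade); nothing here is a statement about the
Navier–Stokes equations; no item is closed; nothing numerical is asserted.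

`OneShiftFrame.gz_mem_of_gridCE` — at its flight time every admissible run of the centred grid has its renormalisation
factor `g` in `G` (part LIX `gfac_mem_of_gridCE`) AND its shell-`0` values `z_{i,0}(τ)` in the flight-time hull rows
`Zb[e(i,0)]` (the same final-step hull `Hs_S ⊆ Zb` certified by `linkK1`).  `OneShiftFrame.hA1_of_gridCE` — hence, for the
CONSTRUCTED window certificate: if `|g·z − t| ≤ A₁` for all `g ∈ G`, `z ∈ Zb[e(i,0)]` and all `t` in a box `cb i` containing the
wake tube centre `tubeC i (−1)` (a finite dyadic computation for the data), then the wake-entry clause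
`|g·z_{i,0}(τ) − tubeC i (−1)| ≤ A₁` holds for every admissible point — the clause `hA1` of `T4W76R.ClausesFor` & co.
-/

noncomputable section

-- the sub-problem namespace repeats the summit name by design (D-0017)
set_option linter.dupNamespace false

namespace Summit.NavierStokesRegularity.NavierStokesRegularity.Theorems

namespace DSSOneShift

open Set Finset Metric Filter Topology TopologicalSpace
open Literature.Analysis.ODE Literature.Analysis.FluidPDE Literature.Analysis.FluidPDE.TaoCascade
open Summit.NavierStokesRegularity.NavierStokesRegularity.Theorems.TaylorModelCert
open Summit.NavierStokesRegularity.NavierStokesRegularity.Theorems.TaylorModelReadout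
open Summit.NavierStokesRegularity.NavierStokesRegularity.Theorems.CertificateGlueOn

variable {m : ℕ}

namespace OneShiftFrame

variable (F : OneShiftFrame m)

section Glue

variable {ε₀ : ℝ} {α : Fin m → Fin m → Fin m → ℤ × ℤ × ℤ → ℝ} {R : ℤ → ℝ}
variable {g : GridCD} {kd : KrawD} {e : F.SIdx ≃ Fin g.n}
variable {κ : Type*} [Fintype κ]

/-- **AT ITS FLIGHT TIME EVERY ADMISSIBLE RUN HAS `g ∈ G` AND ITS SHELL-0 VALUES IN THE ROWS `Zb[e(i,0)]`** (the two
enclosures behind `hgl` and `hA1`: part LIX `gfac_mem_of_gridCE` and the final-step hull `Hs_S ⊆ Zb` of `linkK1`).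
[cite: Tao2016AveragedNS, §5.3; Moore1979, §3.2 and §8.1; cell vocabulary, harvest/h2-tao-ladder rung1/RUNG1-P2G9-REPORT.md §37 (hgl, hA1)] -/
theorem gz_mem_of_gridCE (hε : 0 ≤ ε₀) (hα : IsCancellingCoeff α)
    (hEb : ∀ i, |F.tubeC i (-1)| + F.tubeR (-1) ≤ F.Eb) (hEt : ∀ i, |F.tubeC i F.W| + F.tubeR F.W ≤ F.Et)
    (M : F.FrameMatch g.toGridD kd e R) (hkn : kd.rs.n = g.n)
    (Tc : ℕ → κ → BTerm F.SIdx) (rows : F.SIdx → List κ) (Tf : F.Space → ℝ → κ → BTerm F.SIdx)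
    (hTf : ∀ u t x, termField (Tf u t) x = F.wfieldFlat ε₀ α (F.preclampTail u) t x)
    (hRDc : ∀ s ≤ g.S, IsRTEncl (g.es e M.hn s) (Tc s) (Tc s) rows (g.step s).RD)
    (hRD : ∀ u : F.Space, ∀ s ≤ g.S, ∀ r ∈ Ico 0 (g.h s).toReal,
      IsRTEncl (g.es e M.hn s) (Tc s) (Tf u (g.t s + r)) rows (g.step s).RD)
    (hstep : ∀ s ≤ g.S, g.stepOK s = true) (hinit : g.initOK = true) (hprod : ∀ s < g.S, g.prodOKE s = true)
    (hprodS : g.prodOK g.S = true)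
    (hpwf : ∀ s ≤ g.S, g.pwfOK s = true) (hpsub : ∀ s ≤ g.S, g.psubOK s = true)
    (hplink : ∀ s < g.S, g.plinkOK s = true) (hwlink : ∀ s < g.S, g.wlinkOK s = true) (hK1 : g.linkK1 kd = true)
    (hP0 : (fun c : F.SIdx => F.yc c.1 ((c.2 : ℕ) : ℤ)) ∈ boxSet (boxOf e (g.P 0)))
    {w : F.Space} (hw : F.Adm w) :
    IntervalD.mem (gfac (slice (F.windowRunMap ε₀ α (F.preclampY w) (F.preclampTail w)) (F.preclampTau w))) kd.rs.G ∧
    ∀ i : Fin m, IntervalD.mem (F.windowRunMap ε₀ α (F.preclampY w) (F.preclampTail w) i 0 (F.preclampTau w))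
      (IntervalD.aget kd.rs.Zb (e (i, ⟨0, lt_trans zero_lt_one M.hW1⟩))) := by
  classical
  have hW1 := M.hW1
  have hn := M.hn
  have hW : 0 < F.W := lt_trans zero_lt_one hW1
  refine ⟨F.gfac_mem_of_gridCE hε hα hEb hEt M hkn Tc rows Tf hTf hRDc hRD hstep hinit hprod hprodS hpwf hpsub hplink
    hwlink hK1 hP0 hw, ?_⟩
  obtain ⟨-, hZb, -, -, -, -, -, -⟩ := g.of_linkK1 hK1
  -- facts of the final step
  have hchkS : (g.step g.S).check = true := by
    have := hstep g.S le_rfl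
    simp only [GridD.stepOK, Bool.and_eq_true, decide_eq_true_eq] at this
    exact this.1
  have hc' : (g.step g.S).toRoughStepD.check = true ∧ (g.step g.S).checkPair = true := by
    simpa [PairStepD.check, Bool.and_eq_true] using hchkS
  have hrc' : (g.step g.S).toRoughStepD.centre.check = true ∧ (g.step g.S).toRoughStepD.checkKZ = true := by
    simpa [RoughStepD.check, Bool.and_eq_true] using hc'.1
  obtain ⟨heta, hKZ⟩ := (g.step g.S).toRoughStepD.of_checkKZ hrc'.2
  have hcw := (g.step g.S).toRoughStepD.centre.of_checkWith (by rw [← CentreStepD.check_eq]; exact hrc'.1)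
  have hwfS : ∀ c < (g.step g.S).n, wfsD (IntervalD.aget (g.step g.S).S c) = true := fun c hc => (hcw.2.2.1 c hc).2.1
  have hZ : ∀ c < (g.step g.S).n, 0 ≤ (RoughStepD.dget (g.step g.S).Zh c).toReal := fun c hc => (hKZ c hc).1
  have hHsZb : ∀ x ∈ boxSet (boxOf e (g.step g.S).Hs), ∀ c, IntervalD.mem (x c) (IntervalD.aget kd.rs.Zb (e c)) := by
    intro x hx c
    have hx' : x ∈ boxSet (boxOf (g.es e hn g.S) (g.step g.S).Hs) := by rw [GridD.boxOf_es]; exact hx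
    have h := (g.step g.S).toRoughStepD.mem_of_mem_Hs (g.es e hn g.S) hwfS hZ heta hx' c
    rw [GridD.es_val] at h
    exact IntervalD.mem_of_subset (hZb _ (e c).isLt) h
  -- the run of `w` and the reference run
  set Sw := F.windowRunMap ε₀ α (F.preclampY w) (F.preclampTail w) with hSwdef
  have hSw : F.IsRunFrom ε₀ α (F.preclampY w) (F.preclampTail w) Sw := F.isRunFrom_windowRunMap hε hW hα hEb hEt hw
  have hfw : ∀ t ∈ Icc 0 F.τhi, HasDerivWithinAt (F.flatRun Sw) (termField (Tf w t) (F.flatRun Sw t)) (Icc 0 F.τhi) t := by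
    intro t ht
    have h := F.hasDerivWithinAt_flatRun hSw ht
    rwa [← hTf w t] at h
  set Sc := F.windowRunMap ε₀ α (F.preclampY (F.zeroWin w)) (F.preclampTail (F.zeroWin w)) with hScdef
  have hSc : F.IsRunFrom ε₀ α (F.preclampY (F.zeroWin w)) (F.preclampTail (F.zeroWin w)) Sc :=
    F.isRunFrom_windowRunMap hε hW hα hEb hEt (F.adm_zeroWin hw)
  have hfc : ∀ t ∈ Icc 0 F.τhi, HasDerivWithinAt (F.flatRun Sc) (termField (Tf w t) (F.flatRun Sc t)) (Icc 0 F.τhi) t := by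
    intro t ht
    have h := F.hasDerivWithinAt_flatRun hSc ht
    rwa [F.preclampTail_zeroWin, ← hTf w t] at h
  have hSc0 : F.flatRun Sc 0 = fun c : F.SIdx => F.yc c.1 ((c.2 : ℕ) : ℤ) := funext fun c => F.flatRun_zeroWin_zero hSc c
  have ha : F.flatRun Sw 0 ∈ boxSet (boxOf e (g.step 0).W) := M.hW0 _ fun c => F.abs_flatRun_zero_sub_yc_le hSw c
  -- times
  have hτc := F.τc_gt
  have hrτ := F.rτ_pos
  have htS' : g.t g.S ≤ F.τhi := M.htS.trans (by unfold τhi; linarith)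
  have hTS' : F.τhi ≤ g.t g.S + (g.h g.S).toReal := M.hTS.le
  have hτw := F.preclampTau_mem_box w
  have hτw' : F.preclampTau w ∈ Icc (g.t g.S) F.τhi := ⟨M.htS.trans hτw.1, hτw.2⟩
  -- the grid: the run is in the final hull at its flight time
  obtain ⟨-, hhull⟩ := g.exists_flowSlope_of_gridC_uptoE e hn hRDc (hRD w) hstep hinit hprod hprodS hpwf hpsub hplink hwlink htS'
    hTS' hP0 hSc0 hfc ha ha (Su := F.flatRun Sw) (Sv := F.flatRun Sw) rfl rfl hfw hfw
  intro i
  have h := hHsZb _ (hhull _ hτw').1 (i, ⟨0, hW⟩)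
  simpa [flatRun] using h

/-- **THE WAKE-ENTRY CLAUSE `hA1` FROM THE CENTRED GRID**: if `|g·z − t| ≤ A₁` whenever `g ∈ G`, `z ∈ Zb[e(i,0)]` and
`t ∈ cb i` for boxes `cb i ∋ tubeC i (−1)` (a finite comparison of emitted dyadics), then every admissible point's
full family of the constructed certificate satisfies `|g(z)·z_{i,0}(τ) − tubeC i (−1)| ≤ A₁`.
[cite: Tao2016AveragedNS, §5.3; Moore1979, §3.2; cell vocabulary, harvest/h2-tao-ladder rung1/RUNG1-P2G9-REPORT.md §37 (hA1)] -/
theorem hA1_of_gridCE (hε : 0 ≤ ε₀) (hα : IsCancellingCoeff α)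
    (hEb : ∀ i, |F.tubeC i (-1)| + F.tubeR (-1) ≤ F.Eb) (hEt : ∀ i, |F.tubeC i F.W| + F.tubeR F.W ≤ F.Et)
    (M : F.FrameMatch g.toGridD kd e R) (hkn : kd.rs.n = g.n)
    (Tc : ℕ → κ → BTerm F.SIdx) (rows : F.SIdx → List κ) (Tf : F.Space → ℝ → κ → BTerm F.SIdx)
    (hTf : ∀ u t x, termField (Tf u t) x = F.wfieldFlat ε₀ α (F.preclampTail u) t x)
    (hRDc : ∀ s ≤ g.S, IsRTEncl (g.es e M.hn s) (Tc s) (Tc s) rows (g.step s).RD)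
    (hRD : ∀ u : F.Space, ∀ s ≤ g.S, ∀ r ∈ Ico 0 (g.h s).toReal,
      IsRTEncl (g.es e M.hn s) (Tc s) (Tf u (g.t s + r)) rows (g.step s).RD)
    (hstep : ∀ s ≤ g.S, g.stepOK s = true) (hinit : g.initOK = true) (hprod : ∀ s < g.S, g.prodOKE s = true)
    (hprodS : g.prodOK g.S = true)
    (hpwf : ∀ s ≤ g.S, g.pwfOK s = true) (hpsub : ∀ s ≤ g.S, g.psubOK s = true)
    (hplink : ∀ s < g.S, g.plinkOK s = true) (hwlink : ∀ s < g.S, g.wlinkOK s = true) (hK1 : g.linkK1 kd = true)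
    (hP0 : (fun c : F.SIdx => F.yc c.1 ((c.2 : ℕ) : ℤ)) ∈ boxSet (boxOf e (g.P 0)))
    (cb : Fin m → IntervalD) (hcb : ∀ i, IntervalD.mem (F.tubeC i (-1)) (cb i)) (A1 : ℝ)
    (hA1D : ∀ i : Fin m, ∀ gv zv tv : ℝ, IntervalD.mem gv kd.rs.G →
      IntervalD.mem zv (IntervalD.aget kd.rs.Zb (e (i, ⟨0, lt_trans zero_lt_one M.hW1⟩))) → IntervalD.mem tv (cb i) →
      |gv * zv - tv| ≤ A1)
    (C : F.WState × ℝ → F.WState × ℝ) (hC : ∀ r, C r = 0 → r = 0) :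
    ∀ w, F.Adm w → ∀ i,
      |gfac (slice (F.fullFamily (F.windowCertOfMatrix hε (lt_trans zero_lt_one M.hW1) hα hEb hEt C hC) w) (F.decodeTau w)) *
          F.fullFamily (F.windowCertOfMatrix hε (lt_trans zero_lt_one M.hW1) hα hEb hEt C hC) w i 0 (F.decodeTau w) -
        F.tubeC i (-1)| ≤ A1 := by
  intro w hw i
  obtain ⟨hG, hz⟩ := F.gz_mem_of_gridCE hε hα hEb hEt M hkn Tc rows Tf hTf hRDc hRD hstep hinit hprod hprodS hpwf hpsub hplink
    hwlink hK1 hP0 hw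
  have hfull : F.fullFamily (F.windowCertOfMatrix hε (lt_trans zero_lt_one M.hW1) hα hEb hEt C hC) w =
      F.windowRunMap ε₀ α (F.preclampY w) (F.preclampTail w) := rfl
  rw [hfull, ← F.preclampTau_eq_decodeTau hw]
  exact hA1D i _ _ _ hG (hz i) (hcb i)

end Glue

end OneShiftFrame

end DSSOneShift

end Summit.NavierStokesRegularity.NavierStokesRegularity.Theorems
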